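import Summits.ValiantsHypothesis.ValiantsHypothesis.Theorems.SymPencilPerFourPeeledTwoPencilKey
import Summits.ValiantsHypothesis.ValiantsHypothesis.Theorems.SymPencilPerFourInnerRankPureGramKernel

/-!
# Route `SymPencil` — inner rank of the `2 | 2` row split of `per_4`, PEELED case: the
# TWO-PENCIL FRAME ENGINE, part 2 — the Gram engine
# (`--supports` stmt-ValiantsHypothesis-5674 `SdcSuperquadratic`; (8,8) column of the size tables,
# memo `NOTE-p8g15-5674-R2-two-pencil.md` §2; rung currency only)

In the peeled reduced family choose `a₀, a₁, y₀, y₁` with `ψ(a_j, y_i) = 0`; the sixteen vectors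
`n^i_b = ν(e_b, y_i)`, `m^j_l = μ(a_j, e_l)` have the doubled Gram table
`[[0, P₀₀, A, P₀₁], [P₀₀, 0, P₁₀, A'], [-A, P₁₀, 0, P₁₁], [P₀₁, -A', P₁₁, 0]]` (`P_ij` pure
permanent data, `A, A'` alternating) and, with `v₀, v₀'`, live in `K^κ`.
**Theorem** (`twelve_le_card_of_gram`, pure linear algebra): vectors in `K^κ` with that Gram table
(`P`'s symmetric, `A, A'` alternating, `W₀ P₀₀ = 1`), `v₀, v₀'` orthogonal to them, isotropic, with
`⟨v₀, v₀'⟩ ≠ 0`, and a non-zero `2 × 2` minor of the Schur complement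
`S = [[A W₀ P₁₀ - P₁₀ W₀ A, A W₀ A' - P₁₀ W₀ P₀₁ + P₁₁], [-P₀₁ W₀ P₁₀ + A' W₀ A + P₁₁, -P₀₁ W₀ A' + A' W₀ P₀₁]]`
(supplied by `…PeeledTwoPencilKey.exists_minor`) force `12 ≤ |κ|`: the Gram map of the eighteen
vectors factors through `K^κ` and its kernel is killed by an explicit onto map to `K¹²`
(`…PureGramKernel.twelve_le_card_of_gram_ker_le`).  The design-side file and the frame-existence
case analysis over `Ψ` are separate.  Honest framing: helper theorem; no cell closes here; the
window `27 ≤ sdc(per_4) ≤ 29`, the crux `SdcSuperquadratic` and `VP ≠ VNP` are untouched.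
No definitions, no named facts. [folklore]
-/

noncomputable section

-- single-conjunct layout: Sub = Summit, duplicated namespace component intended
set_option linter.dupNamespace false

namespace Summit.ValiantsHypothesis.ValiantsHypothesis.Theorems.SymPencilPerFourPeeledTwoPencil

open Matrix Finset Module
open Summit.ValiantsHypothesis.ValiantsHypothesis.Theorems.SymPencilPerFourInnerRankPureGramKernel
open Summit.ValiantsHypothesis.ValiantsHypothesis.Theorems.SymPencilPerFourPeeledTwoPencilKey

universe u v

variable {K : Type u} [Field K]

/-! ### The engine: a two-pencil frame with a non-zero Schur minor forces `12 ≤ |κ|` -/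

/-- **Two-pencil Gram engine** (see the module docstring): the doubled Gram table of a two-pencil
frame, `v₀, v₀'` orthogonal to it with `⟨v₀, v₀'⟩ ≠ 0`, `W₀ P₀₀ = 1` and a non-zero `2 × 2` minor of
the Schur complement force `12 ≤ |κ|`. [folklore] -/
theorem twelve_le_card_of_gram {κ : Type v} [Fintype κ] [DecidableEq κ] (c : κ → K)
    (n₀ m₀ n₁ m₁ : Fin 4 → κ → K) (v₀ v₀' : κ → K)
    (A A' P₀₀ P₁₀ P₀₁ P₁₁ W₀ : Matrix (Fin 4) (Fin 4) K) (hA : Aᵀ = -A) (hA' : A'ᵀ = -A')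
    (hP₀₀ : P₀₀ᵀ = P₀₀) (hP₁₀ : P₁₀ᵀ = P₁₀) (hP₀₁ : P₀₁ᵀ = P₀₁) (hP₁₁ : P₁₁ᵀ = P₁₁)
    (hW₀ : W₀ * P₀₀ = 1)
    (g₀₀ : ∀ b b', ∑ r, c r * n₀ b r * n₀ b' r = 0)
    (g₂₂ : ∀ b b', ∑ r, c r * n₁ b r * n₁ b' r = 0)
    (g₀₂ : ∀ b b', 2 * ∑ r, c r * n₀ b r * n₁ b' r = A b b')
    (g₁₁ : ∀ l l', ∑ r, c r * m₀ l r * m₀ l' r = 0)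
    (g₃₃ : ∀ l l', ∑ r, c r * m₁ l r * m₁ l' r = 0)
    (g₁₃ : ∀ l l', 2 * ∑ r, c r * m₀ l r * m₁ l' r = A' l l')
    (g₀₁ : ∀ b l, 2 * ∑ r, c r * n₀ b r * m₀ l r = P₀₀ b l)
    (g₂₁ : ∀ b l, 2 * ∑ r, c r * n₁ b r * m₀ l r = P₁₀ b l)
    (g₀₃ : ∀ b l, 2 * ∑ r, c r * n₀ b r * m₁ l r = P₀₁ b l)
    (g₂₃ : ∀ b l, 2 * ∑ r, c r * n₁ b r * m₁ l r = P₁₁ b l)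
    (gv₀ : ∀ b, ∑ r, c r * v₀ r * n₀ b r = 0 ∧ ∑ r, c r * v₀ r * m₀ b r = 0 ∧
      ∑ r, c r * v₀ r * n₁ b r = 0 ∧ ∑ r, c r * v₀ r * m₁ b r = 0)
    (gv₀' : ∀ b, ∑ r, c r * v₀' r * n₀ b r = 0 ∧ ∑ r, c r * v₀' r * m₀ b r = 0 ∧
      ∑ r, c r * v₀' r * n₁ b r = 0 ∧ ∑ r, c r * v₀' r * m₁ b r = 0)
    (hQ₀ : ∑ r, c r * v₀ r * v₀ r = 0) (hQ₀' : ∑ r, c r * v₀' r * v₀' r = 0)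
    (hlam : ∑ r, c r * v₀ r * v₀' r ≠ 0)
    (hminor : ∃ ρ₁ ρ₂ γ₁ γ₂ : Fin 4 ⊕ Fin 4,
      (Matrix.fromBlocks (A * W₀ * P₁₀ - P₁₀ * W₀ * A) (A * W₀ * A' - P₁₀ * W₀ * P₀₁ + P₁₁)
          (-(P₀₁ * W₀ * P₁₀) + A' * W₀ * A + P₁₁) (-(P₀₁ * W₀ * A') + A' * W₀ * P₀₁)) ρ₁ γ₁ *
        (Matrix.fromBlocks (A * W₀ * P₁₀ - P₁₀ * W₀ * A) (A * W₀ * A' - P₁₀ * W₀ * P₀₁ + P₁₁)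
          (-(P₀₁ * W₀ * P₁₀) + A' * W₀ * A + P₁₁) (-(P₀₁ * W₀ * A') + A' * W₀ * P₀₁)) ρ₂ γ₂ -
      (Matrix.fromBlocks (A * W₀ * P₁₀ - P₁₀ * W₀ * A) (A * W₀ * A' - P₁₀ * W₀ * P₀₁ + P₁₁)
          (-(P₀₁ * W₀ * P₁₀) + A' * W₀ * A + P₁₁) (-(P₀₁ * W₀ * A') + A' * W₀ * P₀₁)) ρ₁ γ₂ *
        (Matrix.fromBlocks (A * W₀ * P₁₀ - P₁₀ * W₀ * A) (A * W₀ * A' - P₁₀ * W₀ * P₀₁ + P₁₁)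
          (-(P₀₁ * W₀ * P₁₀) + A' * W₀ * A + P₁₁) (-(P₀₁ * W₀ * A') + A' * W₀ * P₀₁)) ρ₂ γ₁ ≠ 0) :
    12 ≤ Fintype.card κ := by
  classical
  obtain ⟨ρ₁, ρ₂, γ₁, γ₂, hmin⟩ := hminor
  set S : Matrix (Fin 4 ⊕ Fin 4) (Fin 4 ⊕ Fin 4) K :=
    Matrix.fromBlocks (A * W₀ * P₁₀ - P₁₀ * W₀ * A) (A * W₀ * A' - P₁₀ * W₀ * P₀₁ + P₁₁)
      (-(P₀₁ * W₀ * P₁₀) + A' * W₀ * A + P₁₁) (-(P₀₁ * W₀ * A') + A' * W₀ * P₀₁) with hSdef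
  -- the weighted pairing and its symmetry
  have wsym : ∀ x x' : κ → K, ∑ r, c r * x r * x' r = ∑ r, c r * x' r * x r :=
    fun x x' => Finset.sum_congr rfl fun r _ => by ring
  -- generators, indexed by `J = (Fin 4 × Fin 4) ⊕ Fin 2`
  let U : Fin 4 → Fin 4 → κ → K := ![n₀, m₀, n₁, m₁]
  let V : Fin 2 → κ → K := ![v₀, v₀']
  let u : (Fin 4 × Fin 4) ⊕ Fin 2 → κ → K := Sum.elim (fun p => U p.1 p.2) V
  have hu0 : ∀ k, u (Sum.inl (0, k)) = n₀ k := fun k => rfl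
  have hu1 : ∀ k, u (Sum.inl (1, k)) = m₀ k := fun k => rfl
  have hu2 : ∀ k, u (Sum.inl (2, k)) = n₁ k := fun k => rfl
  have hu3 : ∀ k, u (Sum.inl (3, k)) = m₁ k := fun k => rfl
  have huv0 : u (Sum.inr 0) = v₀ := rfl
  have huv1 : u (Sum.inr 1) = v₀' := rfl
  -- coordinate projections (linear)
  let π₀ : (((Fin 4 × Fin 4) ⊕ Fin 2) → K) →ₗ[K] (Fin 4 → K) :=
    LinearMap.funLeft K K (fun k => Sum.inl (0, k))
  let π₁ : (((Fin 4 × Fin 4) ⊕ Fin 2) → K) →ₗ[K] (Fin 4 → K) :=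
    LinearMap.funLeft K K (fun k => Sum.inl (1, k))
  let π₂₃ : (((Fin 4 × Fin 4) ⊕ Fin 2) → K) →ₗ[K] (Fin 4 ⊕ Fin 4 → K) :=
    LinearMap.funLeft K K (Sum.elim (fun k => Sum.inl (2, k)) (fun k => Sum.inl (3, k)))
  let π₂ : (((Fin 4 × Fin 4) ⊕ Fin 2) → K) →ₗ[K] (Fin 4 → K) :=
    LinearMap.funLeft K K (fun k => Sum.inl (2, k))
  let π₃ : (((Fin 4 × Fin 4) ⊕ Fin 2) → K) →ₗ[K] (Fin 4 → K) :=
    LinearMap.funLeft K K (fun k => Sum.inl (3, k))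
  let πv : (((Fin 4 × Fin 4) ⊕ Fin 2) → K) →ₗ[K] (Fin 2 → K) :=
    LinearMap.funLeft K K (fun i => Sum.inr i)
  -- the four component maps of `Θ`
  let Θ₁ : (((Fin 4 × Fin 4) ⊕ Fin 2) → K) →ₗ[K] (Fin 4 → K) :=
    π₀ + (W₀ * P₁₀).mulVecLin ∘ₗ π₂ + (W₀ * A').mulVecLin ∘ₗ π₃
  let Θ₂ : (((Fin 4 × Fin 4) ⊕ Fin 2) → K) →ₗ[K] (Fin 4 → K) :=
    π₁ + (W₀ * A).mulVecLin ∘ₗ π₂ + (W₀ * P₀₁).mulVecLin ∘ₗ π₃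
  let Θ₄ : (((Fin 4 × Fin 4) ⊕ Fin 2) → K) →ₗ[K] (Fin 4 ⊕ Fin 4 → K) := S.mulVecLin ∘ₗ π₂₃
  let ρ : Fin 2 → Fin 4 ⊕ Fin 4 := ![ρ₁, ρ₂]
  let Θ : (((Fin 4 × Fin 4) ⊕ Fin 2) → K) →ₗ[K] (((Fin 4 ⊕ Fin 4) ⊕ (Fin 2 ⊕ Fin 2)) → K) :=
    LinearMap.pi (Sum.elim
      (Sum.elim (fun b => (LinearMap.proj b) ∘ₗ Θ₁) (fun b => (LinearMap.proj b) ∘ₗ Θ₂))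
      (Sum.elim (fun i => (LinearMap.proj i) ∘ₗ πv) (fun i => (LinearMap.proj (ρ i)) ∘ₗ Θ₄)))
  have hΘ₁ : ∀ z b, Θ z (Sum.inl (Sum.inl b)) =
      z (Sum.inl (0, b)) + ((W₀ * P₁₀) *ᵥ (fun k => z (Sum.inl (2, k)))) b +
        ((W₀ * A') *ᵥ (fun k => z (Sum.inl (3, k)))) b := by
    intro z b
    simp only [Θ, Θ₁, π₀, π₂, π₃, LinearMap.pi_apply, Sum.elim_inl, LinearMap.coe_comp,
      Function.comp_apply, LinearMap.coe_proj, Function.eval, LinearMap.add_apply, Pi.add_apply,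
      Matrix.mulVecLin_apply, LinearMap.funLeft_apply]
    rfl
  have hΘ₂ : ∀ z b, Θ z (Sum.inl (Sum.inr b)) =
      z (Sum.inl (1, b)) + ((W₀ * A) *ᵥ (fun k => z (Sum.inl (2, k)))) b +
        ((W₀ * P₀₁) *ᵥ (fun k => z (Sum.inl (3, k)))) b := by
    intro z b
    simp only [Θ, Θ₂, π₁, π₂, π₃, LinearMap.pi_apply, Sum.elim_inl, Sum.elim_inr, LinearMap.coe_comp,
      Function.comp_apply, LinearMap.coe_proj, Function.eval, LinearMap.add_apply, Pi.add_apply,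
      Matrix.mulVecLin_apply, LinearMap.funLeft_apply]
    rfl
  have hΘ₃ : ∀ z i, Θ z (Sum.inr (Sum.inl i)) = z (Sum.inr i) := by
    intro z i
    simp only [Θ, πv, LinearMap.pi_apply, Sum.elim_inr, Sum.elim_inl, LinearMap.coe_comp,
      Function.comp_apply, LinearMap.coe_proj, Function.eval, LinearMap.funLeft_apply]
  have hΘ₄ : ∀ z i, Θ z (Sum.inr (Sum.inr i)) =
      (S *ᵥ Sum.elim (fun k => z (Sum.inl (2, k))) (fun k => z (Sum.inl (3, k)))) (ρ i) := by
    intro z i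
    simp only [Θ, Θ₄, π₂₃, LinearMap.pi_apply, Sum.elim_inr, LinearMap.coe_comp,
      Function.comp_apply, LinearMap.coe_proj, Function.eval, Matrix.mulVecLin_apply]
    congr 1
    funext y; rcases y with y | y <;> rfl
  have hcard : Fintype.card ((Fin 4 ⊕ Fin 4) ⊕ (Fin 2 ⊕ Fin 2)) = 12 := by simp
  -- `W₀` is a two-sided inverse and symmetric
  have hW₀' : P₀₀ * W₀ = 1 := mul_eq_one_comm.1 hW₀
  -- symmetric entries
  have sy : ∀ (P : Matrix (Fin 4) (Fin 4) K), Pᵀ = P → ∀ i j, P i j = P j i := by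
    intro P hP i j
    have h := congr_fun (congr_fun hP j) i
    rw [transpose_apply] at h
    exact h
  -- SURJECTIVITY of Θ
  have hsurj : Function.Surjective Θ := by
    intro g
    set mnr := S ρ₁ γ₁ * S ρ₂ γ₂ - S ρ₁ γ₂ * S ρ₂ γ₁ with hmnr
    set t₁ := g (Sum.inr (Sum.inr 0)) with ht₁
    set t₂ := g (Sum.inr (Sum.inr 1)) with ht₂
    set α : K := (S ρ₂ γ₂ * t₁ - S ρ₁ γ₂ * t₂) / mnr with hα
    set β : K := (S ρ₁ γ₁ * t₂ - S ρ₂ γ₁ * t₁) / mnr with hβ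
    set rv : Fin 4 ⊕ Fin 4 → K := Pi.single γ₁ α + Pi.single γ₂ β with hrv
    have hSrv : ∀ x, (S *ᵥ rv) x = S x γ₁ * α + S x γ₂ * β := by
      intro x
      simp only [hrv, Matrix.mulVec, dotProduct_add, dotProduct_single]
    set w₂ : Fin 4 → K := fun k => rv (Sum.inl k) with hw₂
    set w₃ : Fin 4 → K := fun k => rv (Sum.inr k) with hw₃
    have hw : Sum.elim w₂ w₃ = rv := by funext y; rcases y with y | y <;> rfl
    set w₀ : Fin 4 → K := fun b => g (Sum.inl (Sum.inl b)) -
      (((W₀ * P₁₀) *ᵥ w₂) b + ((W₀ * A') *ᵥ w₃) b) with hw₀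
    set w₁ : Fin 4 → K := fun b => g (Sum.inl (Sum.inr b)) -
      (((W₀ * A) *ᵥ w₂) b + ((W₀ * P₀₁) *ᵥ w₃) b) with hw₁
    let Wblk : Fin 4 → Fin 4 → K := ![w₀, w₁, w₂, w₃]
    let zs : (Fin 4 × Fin 4) ⊕ Fin 2 → K :=
      Sum.elim (fun p => Wblk p.1 p.2) (fun i => g (Sum.inr (Sum.inl i)))
    have hz2 : (fun k => zs (Sum.inl (2, k))) = w₂ := rfl
    have hz3 : (fun k => zs (Sum.inl (3, k))) = w₃ := rfl
    refine ⟨zs, funext fun x => ?_⟩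
    rcases x with (b | b) | (i | i)
    · rw [hΘ₁, hz2, hz3]
      change w₀ b + _ + _ = _
      rw [hw₀]; ring
    · rw [hΘ₂, hz2, hz3]
      change w₁ b + _ + _ = _
      rw [hw₁]; ring
    · rw [hΘ₃]; rfl
    · rw [hΘ₄, hz2, hz3, hw, hSrv]
      fin_cases i
      · change S ρ₁ γ₁ * α + S ρ₁ γ₂ * β = g (Sum.inr (Sum.inr 0))
        rw [← ht₁, hα, hβ]
        field_simp
        ring
      · change S ρ₂ γ₁ * α + S ρ₂ γ₂ * β = g (Sum.inr (Sum.inr 1))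
        rw [← ht₂, hα, hβ]
        field_simp
        ring
  -- KERNEL: the Gram kernel equations imply `Θ z = 0`
  have hker : ∀ z : (Fin 4 × Fin 4) ⊕ Fin 2 → K,
      (∀ j', ∑ j, z j * ∑ r, c r * u j r * u j' r = 0) → Θ z = 0 := by
    intro z hz
    -- block coordinates
    set z0 : Fin 4 → K := fun k => z (Sum.inl (0, k)) with hz0
    set z1 : Fin 4 → K := fun k => z (Sum.inl (1, k)) with hz1
    set z2 : Fin 4 → K := fun k => z (Sum.inl (2, k)) with hz2
    set z3 : Fin 4 → K := fun k => z (Sum.inl (3, k)) with hz3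
    -- expansion of the Gram pairing against a fixed vector `X`
    have hexp : ∀ X : κ → K, ∑ j, z j * ∑ r, c r * u j r * X r =
        ∑ k, z0 k * ∑ r, c r * n₀ k r * X r + ∑ k, z1 k * ∑ r, c r * m₀ k r * X r +
        ∑ k, z2 k * ∑ r, c r * n₁ k r * X r + ∑ k, z3 k * ∑ r, c r * m₁ k r * X r +
        (z (Sum.inr 0) * ∑ r, c r * v₀ r * X r + z (Sum.inr 1) * ∑ r, c r * v₀' r * X r) := by
      intro X
      rw [sum_index_split]
      rfl
    -- doubled entries of the Gram table
    have t01 : ∀ k l, 2 * ∑ r, c r * n₀ k r * m₀ l r = P₀₀ l k := fun k l => by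
      rw [g₀₁ k l, sy P₀₀ hP₀₀ k l]
    have t21 : ∀ k l, 2 * ∑ r, c r * n₁ k r * m₀ l r = P₁₀ l k := fun k l => by
      rw [g₂₁ k l, sy P₁₀ hP₁₀ k l]
    have t03 : ∀ k l, 2 * ∑ r, c r * n₀ k r * m₁ l r = P₀₁ l k := fun k l => by
      rw [g₀₃ k l, sy P₀₁ hP₀₁ k l]
    have t23 : ∀ k l, 2 * ∑ r, c r * n₁ k r * m₁ l r = P₁₁ l k := fun k l => by
      rw [g₂₃ k l, sy P₁₁ hP₁₁ k l]
    have t10 : ∀ k b, 2 * ∑ r, c r * m₀ k r * n₀ b r = P₀₀ b k := fun k b => by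
      rw [wsym, g₀₁ b k]
    have t12 : ∀ k b, 2 * ∑ r, c r * m₀ k r * n₁ b r = P₁₀ b k := fun k b => by
      rw [wsym, g₂₁ b k]
    have t30 : ∀ k b, 2 * ∑ r, c r * m₁ k r * n₀ b r = P₀₁ b k := fun k b => by
      rw [wsym, g₀₃ b k]
    have t32 : ∀ k b, 2 * ∑ r, c r * m₁ k r * n₁ b r = P₁₁ b k := fun k b => by
      rw [wsym, g₂₃ b k]
    have t20 : ∀ k b, 2 * ∑ r, c r * n₁ k r * n₀ b r = A b k := fun k b => by
      rw [wsym, g₀₂ b k]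
    have t31 : ∀ k l, 2 * ∑ r, c r * m₁ k r * m₀ l r = A' l k := fun k l => by
      rw [wsym, g₁₃ l k]
    -- (E1) pairing against `m₀ l'`
    have E1 : ∀ l', (P₀₀ *ᵥ z0 + P₁₀ *ᵥ z2 + A' *ᵥ z3) l' = 0 := by
      intro l'
      have h := hz (Sum.inl (1, l'))
      rw [hu1, hexp] at h
      simp only [g₁₁, (gv₀ l').2.1, (gv₀' l').2.1, mul_zero, add_zero, Finset.sum_const_zero] at h
      simp only [Pi.add_apply, mulVec, dotProduct]
      have e : ∑ k, P₀₀ l' k * z0 k + ∑ k, P₁₀ l' k * z2 k + ∑ k, A' l' k * z3 k =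
          2 * (∑ k, z0 k * ∑ r, c r * n₀ k r * m₀ l' r + ∑ k, z2 k * ∑ r, c r * n₁ k r * m₀ l' r +
            ∑ k, z3 k * ∑ r, c r * m₁ k r * m₀ l' r) := by
        rw [mul_add, mul_add, Finset.mul_sum, Finset.mul_sum, Finset.mul_sum]
        congr 1; congr 1
        · exact Finset.sum_congr rfl fun k _ => by rw [mul_left_comm, t01 k l', mul_comm]
        · exact Finset.sum_congr rfl fun k _ => by rw [mul_left_comm, t21 k l', mul_comm]
        · exact Finset.sum_congr rfl fun k _ => by rw [mul_left_comm, t31 k l', mul_comm]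
      rw [e, h, mul_zero]
    -- (E0) pairing against `n₀ b'`
    have E0 : ∀ b', (P₀₀ *ᵥ z1 + A *ᵥ z2 + P₀₁ *ᵥ z3) b' = 0 := by
      intro b'
      have h := hz (Sum.inl (0, b'))
      rw [hu0, hexp] at h
      simp only [g₀₀, (gv₀ b').1, (gv₀' b').1, mul_zero, add_zero, zero_add,
        Finset.sum_const_zero] at h
      simp only [Pi.add_apply, mulVec, dotProduct]
      have e : ∑ k, P₀₀ b' k * z1 k + ∑ k, A b' k * z2 k + ∑ k, P₀₁ b' k * z3 k =
          2 * (∑ k, z1 k * ∑ r, c r * m₀ k r * n₀ b' r + ∑ k, z2 k * ∑ r, c r * n₁ k r * n₀ b' r +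
            ∑ k, z3 k * ∑ r, c r * m₁ k r * n₀ b' r) := by
        rw [mul_add, mul_add, Finset.mul_sum, Finset.mul_sum, Finset.mul_sum]
        congr 1; congr 1
        · exact Finset.sum_congr rfl fun k _ => by rw [mul_left_comm, t10 k b', mul_comm]
        · exact Finset.sum_congr rfl fun k _ => by rw [mul_left_comm, t20 k b', mul_comm]
        · exact Finset.sum_congr rfl fun k _ => by rw [mul_left_comm, t30 k b', mul_comm]
      rw [e, h, mul_zero]
    -- antisymmetric entries
    have asy : ∀ (M : Matrix (Fin 4) (Fin 4) K), Mᵀ = -M → ∀ i j, M i j = -M j i := by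
      intro M hM i j
      have h := congr_fun (congr_fun hM j) i
      rw [transpose_apply, Matrix.neg_apply] at h
      exact h
    -- (E2) pairing against `n₁ b'`
    have E2 : ∀ b', (-(A *ᵥ z0) + P₁₀ *ᵥ z1 + P₁₁ *ᵥ z3) b' = 0 := by
      intro b'
      have h := hz (Sum.inl (2, b'))
      rw [hu2, hexp] at h
      simp only [g₂₂, (gv₀ b').2.2.1, (gv₀' b').2.2.1, mul_zero, add_zero,
        Finset.sum_const_zero] at h
      simp only [Pi.add_apply, Pi.neg_apply, mulVec, dotProduct]
      have e : -∑ k, A b' k * z0 k + ∑ k, P₁₀ b' k * z1 k + ∑ k, P₁₁ b' k * z3 k =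
          2 * (∑ k, z0 k * ∑ r, c r * n₀ k r * n₁ b' r + ∑ k, z1 k * ∑ r, c r * m₀ k r * n₁ b' r +
            ∑ k, z3 k * ∑ r, c r * m₁ k r * n₁ b' r) := by
        rw [mul_add, mul_add, Finset.mul_sum, Finset.mul_sum, Finset.mul_sum, ← Finset.sum_neg_distrib]
        congr 1; congr 1
        · exact Finset.sum_congr rfl fun k _ => by
            rw [mul_left_comm, g₀₂ k b', asy A hA k b']; ring
        · exact Finset.sum_congr rfl fun k _ => by rw [mul_left_comm, t12 k b', mul_comm]
        · exact Finset.sum_congr rfl fun k _ => by rw [mul_left_comm, t32 k b', mul_comm]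
      rw [e, h, mul_zero]
    -- (E3) pairing against `m₁ l'`
    have E3 : ∀ l', (P₀₁ *ᵥ z0 - A' *ᵥ z1 + P₁₁ *ᵥ z2) l' = 0 := by
      intro l'
      have h := hz (Sum.inl (3, l'))
      rw [hu3, hexp] at h
      simp only [g₃₃, (gv₀ l').2.2.2, (gv₀' l').2.2.2, mul_zero, add_zero,
        Finset.sum_const_zero] at h
      simp only [Pi.add_apply, Pi.sub_apply, mulVec, dotProduct]
      have e : ∑ k, P₀₁ l' k * z0 k - ∑ k, A' l' k * z1 k + ∑ k, P₁₁ l' k * z2 k =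
          2 * (∑ k, z0 k * ∑ r, c r * n₀ k r * m₁ l' r + ∑ k, z1 k * ∑ r, c r * m₀ k r * m₁ l' r +
            ∑ k, z2 k * ∑ r, c r * n₁ k r * m₁ l' r) := by
        rw [mul_add, mul_add, Finset.mul_sum, Finset.mul_sum, Finset.mul_sum, sub_eq_add_neg,
          ← Finset.sum_neg_distrib]
        congr 1; congr 1
        · exact Finset.sum_congr rfl fun k _ => by rw [mul_left_comm, t03 k l', mul_comm]
        · exact Finset.sum_congr rfl fun k _ => by
            rw [mul_left_comm, g₁₃ k l', asy A' hA' k l']; ring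
        · exact Finset.sum_congr rfl fun k _ => by rw [mul_left_comm, t23 k l', mul_comm]
      rw [e, h, mul_zero]
    -- (Ev) pairing against `v₀'` and `v₀`
    have Ev0 : z (Sum.inr 0) = 0 := by
      have h := hz (Sum.inr 1)
      rw [huv1, hexp] at h
      have o1 : ∀ k, ∑ r, c r * n₀ k r * v₀' r = 0 := fun k => by rw [wsym]; exact (gv₀' k).1
      have o2 : ∀ k, ∑ r, c r * m₀ k r * v₀' r = 0 := fun k => by rw [wsym]; exact (gv₀' k).2.1
      have o3 : ∀ k, ∑ r, c r * n₁ k r * v₀' r = 0 := fun k => by rw [wsym]; exact (gv₀' k).2.2.1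
      have o4 : ∀ k, ∑ r, c r * m₁ k r * v₀' r = 0 := fun k => by rw [wsym]; exact (gv₀' k).2.2.2
      simp only [o1, o2, o3, o4, hQ₀', mul_zero, add_zero, zero_add, Finset.sum_const_zero] at h
      exact (mul_eq_zero.1 h).resolve_right hlam
    have Ev1 : z (Sum.inr 1) = 0 := by
      have h := hz (Sum.inr 0)
      rw [huv0, hexp] at h
      have o1 : ∀ k, ∑ r, c r * n₀ k r * v₀ r = 0 := fun k => by rw [wsym]; exact (gv₀ k).1
      have o2 : ∀ k, ∑ r, c r * m₀ k r * v₀ r = 0 := fun k => by rw [wsym]; exact (gv₀ k).2.1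
      have o3 : ∀ k, ∑ r, c r * n₁ k r * v₀ r = 0 := fun k => by rw [wsym]; exact (gv₀ k).2.2.1
      have o4 : ∀ k, ∑ r, c r * m₁ k r * v₀ r = 0 := fun k => by rw [wsym]; exact (gv₀ k).2.2.2
      have hl' : ∑ r, c r * v₀' r * v₀ r ≠ 0 := by rw [wsym]; exact hlam
      simp only [o1, o2, o3, o4, hQ₀, mul_zero, add_zero, zero_add, Finset.sum_const_zero] at h
      exact (mul_eq_zero.1 h).resolve_right hl'
    -- vector forms
    have E1v : P₀₀ *ᵥ z0 + P₁₀ *ᵥ z2 + A' *ᵥ z3 = 0 := funext E1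
    have E0v : P₀₀ *ᵥ z1 + A *ᵥ z2 + P₀₁ *ᵥ z3 = 0 := funext E0
    have E2v : -(A *ᵥ z0) + P₁₀ *ᵥ z1 + P₁₁ *ᵥ z3 = 0 := funext E2
    have E3v : P₀₁ *ᵥ z0 - A' *ᵥ z1 + P₁₁ *ᵥ z2 = 0 := funext E3
    -- solve for `z0`, `z1`
    have hz0s : z0 = -(W₀ *ᵥ (P₁₀ *ᵥ z2 + A' *ᵥ z3)) := by
      have h := congr_arg (fun x => W₀ *ᵥ x) E1v
      simp only [Matrix.mulVec_add, Matrix.mulVec_mulVec, hW₀, Matrix.one_mulVec,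
        Matrix.mulVec_zero] at h
      rw [Matrix.mulVec_add, Matrix.mulVec_mulVec, Matrix.mulVec_mulVec, eq_neg_iff_add_eq_zero,
        ← add_assoc]
      exact h
    have hz1s : z1 = -(W₀ *ᵥ (A *ᵥ z2 + P₀₁ *ᵥ z3)) := by
      have h := congr_arg (fun x => W₀ *ᵥ x) E0v
      simp only [Matrix.mulVec_add, Matrix.mulVec_mulVec, hW₀, Matrix.one_mulVec,
        Matrix.mulVec_zero] at h
      rw [Matrix.mulVec_add, Matrix.mulVec_mulVec, Matrix.mulVec_mulVec, eq_neg_iff_add_eq_zero,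
        ← add_assoc]
      exact h
    -- the Schur rows vanish
    have hS : S *ᵥ Sum.elim z2 z3 = 0 := by
      rw [hSdef, Matrix.fromBlocks_mulVec]
      have c2 : (Sum.elim z2 z3 ∘ Sum.inl) = z2 := rfl
      have c3 : (Sum.elim z2 z3 ∘ Sum.inr) = z3 := rfl
      rw [c2, c3]
      have r1 : (A * W₀ * P₁₀ - P₁₀ * W₀ * A) *ᵥ z2 + (A * W₀ * A' - P₁₀ * W₀ * P₀₁ + P₁₁) *ᵥ z3 = 0 := by
        have h := E2v
        rw [hz0s, hz1s] at h
        rw [← h]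
        simp only [Matrix.mulVec_neg, Matrix.mulVec_add, Matrix.mulVec_mulVec, Matrix.add_mulVec,
          Matrix.sub_mulVec, neg_neg, Matrix.mul_assoc]
        abel
      have r2 : (-(P₀₁ * W₀ * P₁₀) + A' * W₀ * A + P₁₁) *ᵥ z2 + (-(P₀₁ * W₀ * A') + A' * W₀ * P₀₁) *ᵥ z3 = 0 := by
        have h := E3v
        rw [hz0s, hz1s] at h
        rw [← h]
        simp only [Matrix.mulVec_neg, Matrix.mulVec_add, Matrix.mulVec_mulVec, Matrix.add_mulVec,
          Matrix.neg_mulVec, neg_neg, Matrix.mul_assoc, sub_eq_add_neg, neg_add]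
        abel
      rw [r1, r2]
      funext y; rcases y with y | y <;> rfl
    -- conclusion
    funext x
    rcases x with (b | b) | (i | i)
    · rw [hΘ₁, Pi.zero_apply]
      change z0 b + ((W₀ * P₁₀) *ᵥ z2) b + ((W₀ * A') *ᵥ z3) b = 0
      rw [hz0s]
      simp only [Pi.neg_apply, Matrix.mulVec_add, Pi.add_apply, Matrix.mulVec_mulVec]
      ring
    · rw [hΘ₂, Pi.zero_apply]
      change z1 b + ((W₀ * A) *ᵥ z2) b + ((W₀ * P₀₁) *ᵥ z3) b = 0
      rw [hz1s]
      simp only [Pi.neg_apply, Matrix.mulVec_add, Pi.add_apply, Matrix.mulVec_mulVec]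
      ring
    · rw [hΘ₃, Pi.zero_apply]
      fin_cases i
      · exact Ev0
      · exact Ev1
    · rw [hΘ₄, Pi.zero_apply]
      change (S *ᵥ Sum.elim z2 z3) (ρ i) = 0
      rw [hS, Pi.zero_apply]
  exact twelve_le_card_of_gram_ker_le hcard c u Θ hsurj hker

end Summit.ValiantsHypothesis.ValiantsHypothesis.Theorems.SymPencilPerFourPeeledTwoPencil

end
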